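import Summits.ResolutionOfSingularities.ResolutionOfSingularities.Theorems.PurelyInseparableDim4SwapIdentity
import Summits.ResolutionOfSingularities.ResolutionOfSingularities.Theorems.PurelyInseparableDim4TschirnhausCleanVertex
import Summits.ResolutionOfSingularities.ResolutionOfSingularities.Theorems.PurelyInseparableDim4ResConeLevelTwoTriple
import HarnessLib
import HarnessLib.Audit.Tags

/-!
# Purely inseparable four-folds — the RE-PRESENTATION RELATION between two presentations of one point: identity, composition,
# and what it lets one read (cell `res-dim4-pi`, K2(p) lane, brick «swap normalisation», FILE SN3b)

[OURS · counted 0 · cell `res-dim4-pi` · seat res-dim4-p-7 g3 · desk WORD #116.]  Nothing here proves K2(p), `NoIsolatedTrap p p`, or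
resolution of singularities in dimension ≥ 4 / characteristic `p`.  AI kernel work, weaker than expert review.

The relation `ℛ_π(F_A, F_B)` (all data explicit, def-free): a letter bijection `π` (B's letter `i` ↔ A's letter `π i`, B's free letter
`f`), a substitution `θ` of the UNIT CLASS — `θ (π i) = x_i · e_i` (`i ≠ f`), `θ (π f) = x_f · e_f + G`, `e_i(0) ≠ 0`, `G(0) = 0`,
`∂_f G(0) = 0` — a unit `U` and an error `E ∈ 𝔪₀ᴹ` with `F_B = clean(U^p · θ(F_A)) + E`.  FILE SN1 produces it for the two children
of a swap (`π` a transposition), p-11's SN3 pushes it through a light step.  Here: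
* `rel_refl` (a clean `F` is related to itself, `π = 1`), **`rel_comp`** (`ℛ_ρ(F_{A'}, F_A)` and `ℛ_π(F_A, F_B)` give
  `ℛ_{π ∘ ρ}(F_{A'}, F_B)` — several swaps in one window);
* readings through the relation, given an inverse of `θ` modulo `𝔪₀ᴹ` (p-11's J1): the certificate LEVEL is kept (`isCert_of_rel`,
  so one `M` serves a whole window), **`isIsolated_of_rel`**, and `ordZero_of_rel` in the band `p ∤ ord₀`.
bears_on: LADDER-RESOLUTION:D157-DOOR2 (res-dim4-pi · K2(p) · swap normalisation SN3b).  Supports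
stmt-ResolutionOfSingularities-16155 (helper).
-/

set_option linter.dupNamespace false -- mandated namespace of this single-conjunct summit

noncomputable section

namespace Summit.ResolutionOfSingularities.ResolutionOfSingularities.Theorems.PIDim4

namespace SwapNorm

open MvPolynomial Finset
open Literature.AlgebraicGeometry.Resolution
open Literature.AlgebraicGeometry.Resolution.Hauser2010

variable {K : Type} [Field K]

/-! ## §1 Small facts -/

/-- Cleaning only deletes monomials, so it preserves `𝔪₀ᵏ`. [folklore] -/
theorem deletePthPowers_mem_pow (q : ℕ) {k : ℕ} {G : MvPolynomial (Fin 4) K} (h : G ∈ originIdeal K ^ k) :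
    deletePthPowers q G ∈ originIdeal K ^ k := by
  classical
  rw [ApproxCoordChange.mem_pow_iff] at h ⊢
  intro d hd
  rw [coeff_deletePthPowers]
  split_ifs
  · rfl
  · exact h d hd

/-- An origin-fixing substitution keeps `𝔪₀ᵏ`. [folklore] -/
theorem aeval_mem_pow {g : Fin 4 → MvPolynomial (Fin 4) K} (hg : ∀ i, constantCoeff (g i) = 0) {k : ℕ}
    {E : MvPolynomial (Fin 4) K} (hE : E ∈ originIdeal K ^ k) : aeval g E ∈ originIdeal K ^ k :=
  ApproxCoordChange.map_pow_le hg k (Ideal.mem_map_of_mem _ hE)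

/-- A linear coefficient of an element of `𝔪₀²` vanishes. [folklore] -/
theorem coeff_single_eq_zero_of_mem_sq {R : MvPolynomial (Fin 4) K} (hR : R ∈ originIdeal K ^ 2) (i : Fin 4) :
    coeff (Finsupp.single i 1) R = 0 :=
  (ApproxCoordChange.mem_pow_iff 2 R).mp hR _ (by rw [Finsupp.degree_single]; omega)

/-- `x_i · V` has no `x_f`-linear term for `i ≠ f`. [folklore] -/
theorem coeff_single_X_mul {i f : Fin 4} (hif : i ≠ f) (V : MvPolynomial (Fin 4) K) :
    coeff (Finsupp.single f 1) (X i * V) = 0 := by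
  classical
  rw [coeff_X_mul', if_neg]
  rw [Finsupp.mem_support_iff, Finsupp.single_apply, if_neg (Ne.symm hif)]
  exact fun h => h rfl

/-- A polynomial vanishing at `0` is its linear form plus an element of `𝔪₀²`. [folklore] -/
theorem sub_linearForm_mem_sq {G : MvPolynomial (Fin 4) K} (hG0 : constantCoeff G = 0) :
    G - ∑ i, C (coeff (Finsupp.single i 1) G) * X i ∈ originIdeal K ^ 2 := by
  rw [← ResCone.homogeneousComponent_one_eq_linearForm, IsolationCert.originIdeal_eq_idealOfVars,
    ← natCast_le_ordZero_iff_mem_idealOfVars_pow]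
  exact_mod_cast FrameChange.two_le_ordZero_sub_homogeneousComponent_one hG0

section Class

variable {π : Equiv.Perm (Fin 4)} {f : Fin 4} {θ e : Fin 4 → MvPolynomial (Fin 4) K} {G : MvPolynomial (Fin 4) K}

/-- A unit-class substitution fixes the origin. [folklore] -/
theorem unitClass_origin (hθi : ∀ i, i ≠ f → θ (π i) = X i * e i) (hθf : θ (π f) = X f * e f + G)
    (hG0 : constantCoeff G = 0) (k : Fin 4) : constantCoeff (θ k) = 0 := by
  obtain ⟨i, rfl⟩ := π.surjective k
  by_cases hi : i = f
  · subst hi; rw [hθf, map_add, map_mul, constantCoeff_X, zero_mul, zero_add, hG0]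
  · rw [hθi i hi, map_mul, constantCoeff_X, zero_mul]

/-- **First-order chain rule for the free letter**: a unit-class substitution creates no `x_f`-linear term from a polynomial
without `x_{π f}`-linear term. [folklore] -/
theorem coeff_single_aeval_eq_zero (hθi : ∀ i, i ≠ f → θ (π i) = X i * e i) (hθf : θ (π f) = X f * e f + G)
    (hG0 : constantCoeff G = 0) {H : MvPolynomial (Fin 4) K} (hH0 : constantCoeff H = 0)
    (hH1 : coeff (Finsupp.single (π f) 1) H = 0) : coeff (Finsupp.single f 1) (aeval θ H) = 0 := by
  classical
  have hθ0 := unitClass_origin hθi hθf hG0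
  have hsplit : H = ∑ k, C (coeff (Finsupp.single k 1) H) * X k + (H - ∑ k, C (coeff (Finsupp.single k 1) H) * X k) := by
    ring
  rw [hsplit, map_add, coeff_add, coeff_single_eq_zero_of_mem_sq (aeval_mem_pow hθ0 (sub_linearForm_mem_sq hH0)),
    add_zero, map_sum, coeff_sum, ← Equiv.sum_comp π]
  refine Finset.sum_eq_zero fun i _ => ?_
  rw [map_mul, aeval_C, algebraMap_eq, aeval_X, coeff_C_mul]
  by_cases hi : i = f
  · subst hi; rw [hH1, zero_mul]
  · rw [hθi i hi, coeff_single_X_mul hi, mul_zero]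

end Class

/-! ## §2 The identity relation and composition -/

/-- **Identity**: a clean `F` is related to itself (`π = 1`, `θ = x`, `e = 1`, `G = 0`, `U = 1`, `E = 0`). [folklore] -/
theorem rel_refl (p : ℕ) (f : Fin 4) (M : ℕ) {F : MvPolynomial (Fin 4) K} (hF : deletePthPowers p F = F) :
    ∃ (θ e : Fin 4 → MvPolynomial (Fin 4) K) (G U E : MvPolynomial (Fin 4) K),
      (∀ i, i ≠ f → θ ((1 : Equiv.Perm (Fin 4)) i) = X i * e i) ∧ θ ((1 : Equiv.Perm (Fin 4)) f) = X f * e f + G ∧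
      (∀ i, constantCoeff (e i) ≠ 0) ∧ constantCoeff G = 0 ∧ coeff (Finsupp.single f 1) G = 0 ∧
      constantCoeff U ≠ 0 ∧ E ∈ originIdeal K ^ M ∧
      F = deletePthPowers p (U ^ p * aeval θ F) + E := by
  refine ⟨X, fun _ => 1, 0, 1, 0, ?_, ?_, ?_, ?_, ?_, ?_, Ideal.zero_mem _, ?_⟩
  · intro i _; rw [Equiv.Perm.one_apply, mul_one]
  · rw [Equiv.Perm.one_apply, mul_one, add_zero]
  · intro i; rw [map_one]; exact one_ne_zero
  · exact map_zero _
  · exact coeff_zero _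
  · rw [map_one]; exact one_ne_zero
  · rw [one_pow, one_mul, MvPolynomial.aeval_X_left, AlgHom.id_apply, hF, add_zero]

section Comp

variable (p : ℕ) [hp : Fact p.Prime] [CharP K p]

/-- **COMPOSITION.**  `ℛ_ρ(F_{A'}, F_A)` (with `A`'s free letter `π f`) followed by `ℛ_π(F_A, F_B)` (with `B`'s free letter
`f`) is `ℛ_{π.trans ρ}(F_{A'}, F_B)` (B's letter `i` ↔ A''s letter `ρ (π i)`), error level `min M₁ M₂`. [folklore] -/
theorem rel_comp {π ρ : Equiv.Perm (Fin 4)} {f : Fin 4} {M₁ M₂ : ℕ} {FA' FA FB : MvPolynomial (Fin 4) K}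
    {θ₁ e₁ θ₂ e₂ : Fin 4 → MvPolynomial (Fin 4) K} {G₁ U₁ E₁ G₂ U₂ E₂ : MvPolynomial (Fin 4) K}
    (h1i : ∀ k, k ≠ π f → θ₁ (ρ k) = X k * e₁ k) (h1f : θ₁ (ρ (π f)) = X (π f) * e₁ (π f) + G₁)
    (he₁ : ∀ k, constantCoeff (e₁ k) ≠ 0) (hG₁0 : constantCoeff G₁ = 0) (hG₁1 : coeff (Finsupp.single (π f) 1) G₁ = 0)
    (hU₁ : constantCoeff U₁ ≠ 0) (hE₁ : E₁ ∈ originIdeal K ^ M₁)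
    (hrel₁ : FA = deletePthPowers p (U₁ ^ p * aeval θ₁ FA') + E₁)
    (h2i : ∀ i, i ≠ f → θ₂ (π i) = X i * e₂ i) (h2f : θ₂ (π f) = X f * e₂ f + G₂)
    (he₂ : ∀ i, constantCoeff (e₂ i) ≠ 0) (hG₂0 : constantCoeff G₂ = 0) (hG₂1 : coeff (Finsupp.single f 1) G₂ = 0)
    (hU₂ : constantCoeff U₂ ≠ 0) (hE₂ : E₂ ∈ originIdeal K ^ M₂)
    (hrel₂ : FB = deletePthPowers p (U₂ ^ p * aeval θ₂ FA) + E₂) :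
    ∃ (θ e : Fin 4 → MvPolynomial (Fin 4) K) (G U E : MvPolynomial (Fin 4) K),
      (∀ i, i ≠ f → θ ((π.trans ρ) i) = X i * e i) ∧ θ ((π.trans ρ) f) = X f * e f + G ∧
      (∀ i, constantCoeff (e i) ≠ 0) ∧ constantCoeff G = 0 ∧ coeff (Finsupp.single f 1) G = 0 ∧
      constantCoeff U ≠ 0 ∧ E ∈ originIdeal K ^ (min M₁ M₂) ∧
      FB = deletePthPowers p (U ^ p * aeval θ FA') + E := by
  classical
  have h2o : ∀ k, constantCoeff (θ₂ k) = 0 := unitClass_origin h2i h2f hG₂0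
  refine ⟨fun k => aeval θ₂ (θ₁ k), fun i => e₂ i * aeval θ₂ (e₁ (π i)),
    G₂ * aeval θ₂ (e₁ (π f)) + aeval θ₂ G₁, U₂ * aeval θ₂ U₁, deletePthPowers p (U₂ ^ p * aeval θ₂ E₁) + E₂,
    ?_, ?_, ?_, ?_, ?_, ?_, ?_, ?_⟩
  · -- exceptional letters
    intro i hi
    change aeval θ₂ (θ₁ (ρ (π i))) = _
    rw [h1i (π i) (fun h => hi (π.injective h)), map_mul, aeval_X, h2i i hi, mul_assoc]
  · -- the free letter
    change aeval θ₂ (θ₁ (ρ (π f))) = _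
    rw [h1f, map_add, map_mul, aeval_X, h2f]
    ring
  · -- units
    intro i
    rw [map_mul, CoordChange.constantCoeff_aeval_of_origin _ h2o]
    exact mul_ne_zero (he₂ i) (he₁ (π i))
  · -- `G(0) = 0`
    rw [map_add, map_mul, hG₂0, zero_mul, zero_add, CoordChange.constantCoeff_aeval_of_origin _ h2o, hG₁0]
  · -- `∂_f G(0) = 0`
    rw [coeff_add, coeff_single_aeval_eq_zero h2i h2f hG₂0 hG₁0 hG₁1, add_zero]
    have hsplit : G₂ = ∑ k, C (coeff (Finsupp.single k 1) G₂) * X k +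
        (G₂ - ∑ k, C (coeff (Finsupp.single k 1) G₂) * X k) := by ring
    rw [hsplit, add_mul, coeff_add, coeff_single_eq_zero_of_mem_sq (Ideal.mul_mem_right _ _ (sub_linearForm_mem_sq hG₂0)),
      add_zero, Finset.sum_mul, coeff_sum]
    refine Finset.sum_eq_zero fun i _ => ?_
    by_cases hi : i = f
    · subst hi; rw [hG₂1, C_0, zero_mul, zero_mul, coeff_zero]
    · rw [mul_assoc, coeff_C_mul, coeff_single_X_mul hi, mul_zero]
  · -- the unit
    rw [map_mul, CoordChange.constantCoeff_aeval_of_origin _ h2o]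
    exact mul_ne_zero hU₂ hU₁
  · -- the error
    refine Ideal.add_mem _ (Ideal.pow_le_pow_right (min_le_left _ _) (deletePthPowers_mem_pow p
      (Ideal.mul_mem_left _ _ (aeval_mem_pow h2o hE₁)))) (Ideal.pow_le_pow_right (min_le_right _ _) hE₂)
  · -- the identity
    rw [hrel₂, hrel₁, map_add, mul_add, deletePthPowers_add, deletePthPowers_mul_aeval_deletePthPowers, map_mul, map_pow,
      ← mul_assoc, ← mul_pow, ApproxCoordChange.aeval_aeval, add_assoc]

end Comp

/-! ## §3 Readings through the relation -/

section Read

variable (p : ℕ) [hp : Fact p.Prime] [CharP K p]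
variable {θ θ' : Fin 4 → MvPolynomial (Fin 4) K} {U E FA FB : MvPolynomial (Fin 4) K} {M N : ℕ}

/-- **The certificate level passes through the relation** (with an inverse of `θ` modulo `𝔪₀ᴹ`, `N + p + 1 ≤ M`):
`𝔪₀ᴺ ≤ J_p⁺(F_A) + 𝔪₀ᴺ⁺¹` gives `𝔪₀ᴺ ≤ J_p⁺(F_B) + 𝔪₀ᴺ⁺¹`, and `J_p⁺ ≤ 𝔪₀` is kept. [folklore] -/
theorem isCert_of_rel (hθ : ∀ i, constantCoeff (θ i) = 0) (hθ' : ∀ i, constantCoeff (θ' i) = 0)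
    (hθθ' : ∀ i, aeval θ (θ' i) - X i ∈ originIdeal K ^ M) (hθ'θ : ∀ i, aeval θ' (θ i) - X i ∈ originIdeal K ^ M)
    (hU : constantCoeff U ≠ 0) (hE : E ∈ originIdeal K ^ M) (hrel : FB = deletePthPowers p (U ^ p * aeval θ FA) + E)
    (hJ : singLocusIdeal p FA ≤ originIdeal K)
    (hN : originIdeal K ^ N ≤ singLocusIdeal p FA ⊔ originIdeal K ^ (N + 1)) (hM : N + p + 1 ≤ M) :
    singLocusIdeal p FB ≤ originIdeal K ∧ originIdeal K ^ N ≤ singLocusIdeal p FB ⊔ originIdeal K ^ (N + 1) := by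
  have hv : constantCoeff (U ^ p) ≠ 0 := by rw [map_pow]; exact pow_ne_zero _ hU
  -- through `θ`
  have hJ1 : singLocusIdeal p (aeval θ FA) ≤ originIdeal K := ApproxCoordChange.singLocusIdeal_aeval_le_originIdeal hθ hJ
  have hN1 := ApproxCoordChange.isCert_aeval (q := p) hθ hθ' hθθ' hθ'θ hN hM
  -- through `U^p ·` and cleaning
  have hJ2 : singLocusIdeal p (deletePthPowers p (U ^ p * aeval θ FA)) ≤ originIdeal K := by
    rw [IsolatedBand.singLocusIdeal_deletePthPowers, ApproxCoordChange.singLocusIdeal_pow_char_mul]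
    exact Ideal.mul_le_left.trans hJ1
  have hN2 : originIdeal K ^ N ≤ singLocusIdeal p (deletePthPowers p (U ^ p * aeval θ FA)) ⊔ originIdeal K ^ (N + 1) := by
    rw [IsolatedBand.singLocusIdeal_deletePthPowers, ApproxCoordChange.singLocusIdeal_pow_char_mul,
      ApproxCoordChange.span_mul_sup_pow_eq hv]
    exact hN1
  -- through `+ E`
  rw [hrel]
  refine ⟨(ApproxCoordChange.singLocusIdeal_add_le _ hE).trans (sup_le hJ2 (Ideal.pow_le_self (by omega))), ?_⟩
  exact hN2.trans (sup_le ((ApproxCoordChange.singLocusIdeal_le_add _ hE).trans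
    (sup_le_sup_left (Ideal.pow_le_pow_right (by omega)) _)) le_sup_right)

/-- **ISOLATION PASSES THROUGH THE RELATION** (certificate form). [folklore] -/
theorem isIsolated_of_rel (hθ : ∀ i, constantCoeff (θ i) = 0) (hθ' : ∀ i, constantCoeff (θ' i) = 0)
    (hθθ' : ∀ i, aeval θ (θ' i) - X i ∈ originIdeal K ^ M) (hθ'θ : ∀ i, aeval θ' (θ i) - X i ∈ originIdeal K ^ M)
    (hU : constantCoeff U ≠ 0) (hE : E ∈ originIdeal K ^ M) (hrel : FB = deletePthPowers p (U ^ p * aeval θ FA) + E)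
    (hJ : singLocusIdeal p FA ≤ originIdeal K)
    (hN : originIdeal K ^ N ≤ singLocusIdeal p FA ⊔ originIdeal K ^ (N + 1)) (hM : N + p + 1 ≤ M) :
    IsIsolated p FB := by
  obtain ⟨hJ', hN'⟩ := isCert_of_rel p hθ hθ' hθθ' hθ'θ hU hE hrel hJ hN hM
  exact IsolationCert.isIsolated_of_pow_le_sup_pow_succ hJ' hN'

omit hp [CharP K p] in
/-- **`ord₀` passes through the relation** in the band `p ∤ ord₀ F_A` (`ord₀ F_A < M`). [folklore] -/
theorem ordZero_of_rel (hθ : ∀ i, constantCoeff (θ i) = 0) (hθ' : ∀ i, constantCoeff (θ' i) = 0)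
    (hθ'θ : ∀ i, aeval θ' (θ i) - X i ∈ originIdeal K ^ M)
    (hU : constantCoeff U ≠ 0) (hE : E ∈ originIdeal K ^ M) (hrel : FB = deletePthPowers p (U ^ p * aeval θ FA) + E)
    {n : ℕ} (hn : ordZero FA = n) (hpn : ¬ p ∣ n) (hM : n < M) : ordZero FB = n := by
  have h1 : ordZero (aeval θ FA) = n := ApproxCoordChange.ordZero_aeval hθ hθ' hθ'θ hn hM
  have h2 : ordZero (U ^ p * aeval θ FA) = n := by
    rw [ApproxCoordChange.ordZero_unit_mul (by rw [map_pow]; exact pow_ne_zero _ hU), h1]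
  have h3 : ordZero (deletePthPowers p (U ^ p * aeval θ FA)) = n := FrameChange.ordZero_deletePthPowers_of_not_dvd p h2 hpn
  rw [hrel]
  exact ApproxCoordChange.ordZero_add_of_mem_pow h3 hE hM

end Read

end SwapNorm

end Summit.ResolutionOfSingularities.ResolutionOfSingularities.Theorems.PIDim4

end
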